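import Literature.MathematicalPhysics.KineticTheory.SiteChainLaSalleUniqueness
import HarnessLib

/-!
# Site-inhomogeneous chains reach the equilibrium ball with probability bounded below, uniformly on sublevel sets and in the bath temperatures

Topic `Literature/MathematicalPhysics/KineticTheory`, grouping namespace `…KineticTheory.HeatConduction`
(model-free part in `…KineticTheory`). SiteChain version of the pinned chain's
`…OddSectorIrreversibilityCorrectorTheoryUniformReach.lean` (Summits tree): the pointed irreducibility
`SiteChain.UniformlyConfining.langevinKernel_pos_of_mem_nhds_zero` (`SiteChainLaSalleUniqueness.lean`)
gives `P_t(z, G) > 0` for each `z` and all large `t`; here the lower bound is made UNIFORM over an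
energy sublevel set `{H ≤ E}` (compact) and over all bath temperatures below a bound — the
reachability input of a Harris bound with constants uniform in the temperatures.

* `ConfinedDrift.le_sdeKernel_ball_of_flow_uniform` (model-free) — if at time `t` the UNDRIVEN flow
  maps a set `A ⊆ {V ≤ E₀}` into `B(x₀, r/2)`, then `P^{v₁,v₂}_t(z, B(x₀, r)) ≥ p > 0` for all
  `z ∈ A` and all noise vectors with `‖v₁‖ + ‖v₂‖ ≤ cmax` (noise continuity on `{V ≤ E₀}` and the
  small-ball probability of the Brownian pair, which only improves for smaller amplitudes);
* `SiteChain.UniformlyConfining.hamiltonian_freeFlow_lt_uniform` — LaSalle, uniformly on `{H ≤ E}`: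
  the undriven damped flow brings the whole sublevel set into `{H < η₀}` after one time `s₁` and
  keeps it there (pointwise convergence to `0`, continuity in the initial condition, monotonicity
  of `H`, compactness);
* `SiteChain.UniformlyConfining.le_langevinKernel_ball_uniform` — for every `E`, `r > 0`, `Tmax`
  there is `s₁` such that for every `t ≥ s₁` some `p > 0` bounds `P^{T_L,T_R}_t(z, B(0, r)) ≥ p` for
  all `H(z) ≤ E` and all bath temperatures `T_L, T_R ≤ Tmax`, provided `{H < η₀} ⊆ B(0, r/2)` for
  some `η₀ > H(0)` (local coercivity of the energy at the equilibrium).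

## References

* N. Cuneo, J.-P. Eckmann, M. Hairer, L. Rey-Bellet, Electron. J. Probab. **23** (2018) no. 55,
  Prop. 3.3, Cor. 3.4.
* D. W. Stroock, S. R. S. Varadhan, Proc. Sixth Berkeley Symp. III (1972) 333–359 (support theorem).
-/

noncomputable section

open MeasureTheory ProbabilityTheory Filter Topology Set Metric
open scoped NNReal ENNReal

namespace Literature.MathematicalPhysics.KineticTheory

open Literature.Probability.Process Literature.Analysis.ODE

variable {E : Type*} [NormedAddCommGroup E] [NormedSpace ℝ E] [FiniteDimensional ℝ E]
  [CompleteSpace E] [MeasurableSpace E] [BorelSpace E] [SecondCountableTopology E]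

namespace ConfinedDrift

variable {Y : E → E} (D : ConfinedDrift Y)
include D

/-- **Reaching a ball around an attractor of the undriven flow, uniformly in the initial condition
and in the noise vectors** (model-free): if at time `t` the undriven flow maps a set `A` of initial
conditions with `V ≤ E₀` into `B(x₀, r/2)`, then for every amplitude bound `cmax` some `p > 0` has
`P^{v₁,v₂}_t(z, B(x₀, r)) ≥ p` for all `z ∈ A` and all noise vectors (in the noise subspace) with
`‖v₁‖ + ‖v₂‖ ≤ cmax`: the driven flow is `r/2`-close to the undriven one when the noise path is
small on `[0, t]`, uniformly on `{V ≤ E₀}` (`exists_norm_flow_sub_flow_lt`), and the Brownian pair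
is that small with positive probability (`wienerPair_forall_abs_brownian_le_pos`), an event sized
for the largest amplitudes. [cite: CuneoEckmannHairerReyBellet2018, Prop 3.3] -/
theorem le_sdeKernel_ball_of_flow_uniform {A : Set E} {E₀ : ℝ} (hA : ∀ z ∈ A, D.V z ≤ E₀)
    {x₀ : E} {r : ℝ} (hr : 0 < r) (t : ℝ≥0)
    (hflow : ∀ z ∈ A, dist (drivenFlow Y z 0 t) x₀ < r / 2) {cmax : ℝ} (hcmax : 0 ≤ cmax) :
    ∃ p : ℝ≥0∞, 0 < p ∧ ∀ v₁ v₂ : E, v₁ ∈ D.noise → v₂ ∈ D.noise → ‖v₁‖ + ‖v₂‖ ≤ cmax →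
      ∀ z ∈ A, p ≤ sdeKernel Y v₁ v₂ t z (ball x₀ r) := by
  -- continuity in the noise on `[0, t]`, noise bounded by `1`, uniformly on `{V ≤ E₀}`
  obtain ⟨δ, hδ, hcont⟩ := D.exists_norm_flow_sub_flow_lt E₀ 1 (t : ℝ) (half_pos hr)
  -- the small ball of the Brownian pair (sized for the largest amplitudes)
  set ε' : ℝ := min δ 1 / (cmax + 1) with hε'
  have hC : 0 < cmax + 1 := by linarith
  have hε'0 : 0 < ε' := div_pos (lt_min hδ one_pos) hC
  have hε'b : cmax * ε' ≤ min δ 1 := by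
    rw [hε', mul_div_assoc', div_le_iff₀ hC]
    have : 0 ≤ min δ 1 := (lt_min hδ one_pos).le
    nlinarith
  set Aw : Set WienerPair := {ω | ∀ u : ℝ≥0, u ≤ t → |brownian u ω.1| ≤ ε' ∧ |brownian u ω.2| ≤ ε'}
    with hAw
  have hApos : 0 < wienerPair Aw := wienerPair_forall_abs_brownian_le_pos t hε'0
  refine ⟨wienerPair Aw, hApos, fun v₁ v₂ hv₁ hv₂ hamp z hz => ?_⟩
  -- on `Aw`, the solution lands in `B(x₀, r)`
  have hsub : Aw ⊆ (fun ω => sdeSolMap Y v₁ v₂ t z (pairPath ω)) ⁻¹' ball x₀ r := by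
    intro ω hωA
    rw [mem_preimage, mem_ball]
    set n : ℝ → E := pairNoise v₁ v₂ (pairPath ω) with hn
    have hnc : Continuous n := continuous_pairNoise v₁ v₂ (pairPath ω)
    have hnS : ∀ s, n s ∈ D.noise := fun s => pairNoise_mem v₁ v₂ hv₁ hv₂ _ s
    have hnsmall : ∀ s ∈ Icc (0 : ℝ) t, ‖n s‖ ≤ min δ 1 := by
      intro s hs
      have hst : s.toNNReal ≤ t := Real.toNNReal_le_iff_le_coe.2 hs.2
      obtain ⟨h1, h2⟩ := hωA _ hst
      refine (norm_pairNoise_pairPath_le v₁ v₂ ω s).trans (le_trans ?_ hε'b)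
      have hv₁0 : 0 ≤ ‖v₁‖ := norm_nonneg _
      have hv₂0 : 0 ≤ ‖v₂‖ := norm_nonneg _
      have h3 : |brownian s.toNNReal ω.1| * ‖v₁‖ + |brownian s.toNNReal ω.2| * ‖v₂‖ ≤
          (‖v₁‖ + ‖v₂‖) * ε' := by
        nlinarith [mul_le_mul_of_nonneg_left h1 hv₁0, mul_le_mul_of_nonneg_left h2 hv₂0]
      exact h3.trans (mul_le_mul_of_nonneg_right hamp hε'0.le)
    have h0S : ∀ s : ℝ, (0 : ℝ → E) s ∈ D.noise := fun _ => D.noise.zero_mem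
    have h1 : ‖drivenFlow Y z n t - drivenFlow Y z 0 t‖ < r / 2 :=
      hcont z (hA z hz) n 0 hnc continuous_const hnS h0S
        (fun s hs => (hnsmall s hs).trans (min_le_right _ _))
        (fun s _ => by simp)
        (fun s hs => by simpa using (hnsmall s hs).trans (min_le_left _ _))
        t ⟨t.coe_nonneg, le_rfl⟩
    have hsol : sdeSolMap Y v₁ v₂ t z (pairPath ω) = drivenFlow Y z n t := rfl
    rw [hsol]
    calc dist (drivenFlow Y z n t) x₀
        ≤ dist (drivenFlow Y z n t) (drivenFlow Y z 0 t) + dist (drivenFlow Y z 0 t) x₀ :=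
          dist_triangle _ _ _
      _ < r / 2 + r / 2 := by rw [dist_eq_norm]; exact add_lt_add h1 (hflow z hz)
      _ = r := by ring
  -- conclude
  calc wienerPair Aw
      ≤ wienerPair ((fun ω => sdeSolMap Y v₁ v₂ t z (pairPath ω)) ⁻¹' ball x₀ r) := measure_mono hsub
    _ = sdeKernel Y v₁ v₂ t z (ball x₀ r) := (D.sdeKernel_apply' hv₁ hv₂ t z measurableSet_ball).symm

end ConfinedDrift

namespace HeatConduction

namespace SiteChain

namespace UniformlyConfining

variable {N : ℕ} {P : SiteChain}

/-- **LaSalle, uniformly on an energy sublevel set of a site-dependent chain.** For a uniformly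
confining chain with `γ > 0`, `N ≥ 1`, all `V_i'` injective and the origin as the only critical
point of the potential: for every `E` and every `η₀ > H(0)` there is `s₁ ≥ 0` such that the undriven
damped flow satisfies `H(φ_t(z)) < η₀` for all `H(z) ≤ E` and all `t ≥ s₁`. Each trajectory tends to
`0` (`tendsto_freeFlow_zero`), so enters the open set `{H < η₀}` at some time; by continuity in the
initial condition a whole neighbourhood enters at that time; `H` is non-increasing along the flow,
so it stays; and `{H ≤ E}` is compact. [cite: CuneoEckmannHairerReyBellet2018, Prop 3.3] -/
theorem hamiltonian_freeFlow_lt_uniform (hP : P.UniformlyConfining) (N : ℕ) (hγ : 0 < P.γ) (hN : 0 < N)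
    (hVinj : ∀ i, Function.Injective (deriv (P.V i)))
    (hcrit : ∀ q : Fin N → ℝ, (∀ i, P.dPotential N i q = 0) → q = 0) (E : ℝ) {η₀ : ℝ}
    (h0 : P.hamiltonian N 0 < η₀) :
    ∃ s₁ : ℝ, 0 ≤ s₁ ∧ ∀ z : PhaseSpace N, P.hamiltonian N z ≤ E → ∀ t : ℝ, s₁ ≤ t →
      P.hamiltonian N (drivenFlow (P.langevinDrift N) z 0 t) < η₀ := by
  set Hm := P.hamiltonian N with hHm
  have hHc : Continuous Hm := (hP.contDiff_hamiltonian N).continuous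
  -- each point enters `{H < η₀}` at some nonnegative time
  have henter : ∀ z : PhaseSpace N, ∃ tz : ℝ, 0 ≤ tz ∧ Hm (drivenFlow (P.langevinDrift N) z 0 tz) < η₀ := by
    intro z
    have hlim := hP.tendsto_freeFlow_zero N hγ hN hVinj hcrit z
    have hH : Tendsto (fun t => Hm (drivenFlow (P.langevinDrift N) z 0 t)) atTop (𝓝 (Hm 0)) :=
      (hHc.tendsto 0).comp hlim
    have hev : ∀ᶠ t : ℝ in atTop, Hm (drivenFlow (P.langevinDrift N) z 0 t) < η₀ := hH (Iio_mem_nhds h0)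
    obtain ⟨t₁, ht₁⟩ := eventually_atTop.1 hev
    exact ⟨max t₁ 0, le_max_right _ _, ht₁ _ (le_max_left _ _)⟩
  choose tz htz0 htz using henter
  -- the open neighbourhoods entering at that time
  set U : PhaseSpace N → Set (PhaseSpace N) := fun z =>
    {z' | Hm (drivenFlow (P.langevinDrift N) z' 0 (tz z)) < η₀} with hU
  have hUo : ∀ z, IsOpen (U z) := fun z =>
    isOpen_lt (hHc.comp (hP.continuous_freeFlow_left N (tz z))) continuous_const
  have hzU : ∀ z, z ∈ U z := fun z => htz z
  have hC : IsCompact {z : PhaseSpace N | Hm z ≤ E} := hP.isCompact_setOf_hamiltonian_le N E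
  obtain ⟨F, -, hcover⟩ := hC.elim_nhds_subcover U fun z _ => (hUo z).mem_nhds (hzU z)
  refine ⟨∑ z ∈ F, tz z, Finset.sum_nonneg fun z _ => htz0 z, fun z hz t ht => ?_⟩
  have hmem := hcover hz
  simp only [mem_iUnion] at hmem
  obtain ⟨z₀, hz₀F, hzz₀⟩ := hmem
  have htz_le : tz z₀ ≤ t := by
    have h1 : tz z₀ ≤ ∑ z ∈ F, tz z := Finset.single_le_sum (fun z _ => htz0 z) hz₀F
    exact h1.trans ht
  have hsplit : drivenFlow (P.langevinDrift N) z 0 t =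
      drivenFlow (P.langevinDrift N) (drivenFlow (P.langevinDrift N) z 0 (tz z₀)) 0 (t - tz z₀) := by
    have := hP.freeFlow_add N z (htz0 z₀) (sub_nonneg.2 htz_le)
    rw [add_sub_cancel] at this
    exact this
  rw [hsplit]
  exact (hP.hamiltonian_freeFlow_le N _ _).trans_lt hzz₀

/-- The noise vectors of baths at temperatures `≤ Tmax` have amplitude at most `√(2γTmax)` each.
[folklore] -/
theorem norm_noiseVecL_add_norm_noiseVecR_le (hP : P.UniformlyConfining) (N : ℕ) {Tmax T_L T_R : ℝ}
    (hL : T_L ≤ Tmax) (hR : T_R ≤ Tmax) :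
    ‖P.noiseVecL N T_L‖ + ‖P.noiseVecR N T_R‖ ≤ 2 * Real.sqrt (2 * P.γ * Tmax) := by
  have hγ := hP.γ_nonneg
  have h1 : ‖P.noiseVecL N T_L‖ ≤ Real.sqrt (2 * P.γ * Tmax) := by
    refine (norm_bathVec_le N 0 _).trans ?_
    rw [abs_of_nonneg (Real.sqrt_nonneg _)]
    exact Real.sqrt_le_sqrt (by nlinarith)
  have h2 : ‖P.noiseVecR N T_R‖ ≤ Real.sqrt (2 * P.γ * Tmax) := by
    refine (norm_bathVec_le N (N - 1) _).trans ?_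
    rw [abs_of_nonneg (Real.sqrt_nonneg _)]
    exact Real.sqrt_le_sqrt (by nlinarith)
  linarith

/-- **Uniform reachability of the equilibrium ball for a site-dependent chain.** Under the
hypotheses of `hamiltonian_freeFlow_lt_uniform` and a local coercivity of the energy at the
equilibrium (`{H < η₀} ⊆ B(0, r/2)` for some `η₀ > H(0)`): for every energy level `E` and
temperature bound `Tmax` there is `s₁` such that for every `t ≥ s₁` some `p > 0` satisfies
`P^{T_L,T_R}_t(z, B(0, r)) ≥ p` for all `H(z) ≤ E` and all bath temperatures `T_L, T_R ≤ Tmax`: the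
undriven flow is in `B(0, r/2)` from time `s₁` on, and `ConfinedDrift.le_sdeKernel_ball_of_flow_uniform`
applies with the amplitude bound `2√(2γTmax)`. [cite: CuneoEckmannHairerReyBellet2018, Prop 3.3] -/
theorem le_langevinKernel_ball_uniform (hP : P.UniformlyConfining) (N : ℕ) (hγ : 0 < P.γ) (hN : 0 < N)
    (hVinj : ∀ i, Function.Injective (deriv (P.V i)))
    (hcrit : ∀ q : Fin N → ℝ, (∀ i, P.dPotential N i q = 0) → q = 0) (E : ℝ) {r η₀ : ℝ}
    (h0 : P.hamiltonian N 0 < η₀) (hcoer : ∀ x : PhaseSpace N, P.hamiltonian N x < η₀ → ‖x‖ < r / 2)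
    (Tmax : ℝ) :
    ∃ s₁ : ℝ≥0, ∀ t : ℝ≥0, s₁ ≤ t → ∃ p : ℝ≥0∞, 0 < p ∧
      ∀ T_L T_R : ℝ, T_L ≤ Tmax → T_R ≤ Tmax →
        ∀ z : PhaseSpace N, P.hamiltonian N z ≤ E → p ≤ P.langevinKernel N T_L T_R t z (ball 0 r) := by
  have hr : 0 < r := by
    have h := hcoer 0 h0
    rw [norm_zero] at h
    linarith
  -- LaSalle, uniformly on `{H ≤ E}`
  obtain ⟨s₁, hs₁0, hs₁⟩ := hP.hamiltonian_freeFlow_lt_uniform N hγ hN hVinj hcrit E h0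
  refine ⟨⟨s₁, hs₁0⟩, fun t ht => ?_⟩
  have hts₁ : s₁ ≤ (t : ℝ) := by exact_mod_cast ht
  have hfree : ∀ z ∈ {z : PhaseSpace N | P.hamiltonian N z ≤ E},
      dist (drivenFlow (P.langevinDrift N) z 0 t) 0 < r / 2 := fun z hz => by
    rw [dist_zero_right]
    exact hcoer _ (hs₁ z hz t hts₁)
  have hA : ∀ z ∈ {z : PhaseSpace N | P.hamiltonian N z ≤ E}, (hP.confinedDrift N).V z ≤ E :=
    fun z hz => by rw [hP.confinedDrift_V]; exact hz
  obtain ⟨p, hp, hreach⟩ := (hP.confinedDrift N).toConfinedDrift.le_sdeKernel_ball_of_flow_uniform hA hr t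
    hfree (cmax := 2 * Real.sqrt (2 * P.γ * Tmax)) (by positivity)
  refine ⟨p, hp, fun T_L T_R hL hR z hz => ?_⟩
  exact hreach _ _ (hP.noiseVecL_mem_noise N T_L) (hP.noiseVecR_mem_noise N T_R)
    (hP.norm_noiseVecL_add_norm_noiseVecR_le N hL hR) z hz

end UniformlyConfining

end SiteChain

end HeatConduction

end Literature.MathematicalPhysics.KineticTheory

end
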